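import Literature.MathematicalPhysics.QuantumFieldTheory.BalabanImbrieJaffe1984to88.BIJ88GaussianMoments308
import Literature.MathematicalPhysics.QuantumFieldTheory.BalabanImbrieJaffe1984to88.BIJ88ZtPositivity308

/-!
# `BalabanImbrieJaffe1984to88.BIJ88PolyInteraction308` — T. Bałaban, J. Imbrie, A. Jaffe, *Effective action and cluster properties of
the abelian Higgs model*, Commun. Math. Phys. **114** (1988) 257–315 [BalabanImbrieJaffe1988]: Sect. 5.14, pp. 308–309 [PDF 52–53],
verbatim (renders `lit-balaban-r16/renders/cmp114/original-p052-x2.png` and, v1.1, `lit-balaban-ref-1/renders/cmp114/original-p053-x2.png`,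
both re-read as images): p. 308 *"Define z_t(Λ₁₂^{(k)}) for t ∈ [0,1] by replacing Ṽ(Λ₁₂^{(k)}) with tṼ(Λ₁₂^{(k)}), replacing
χ(cp(e_k), (I − Q^{s*}Q)A^{(k)}) with χ(cp(te_k), (I − Q^{s*}Q)A^{(k)}), and similarly for χ(cp(e_k), φ^{(k)})."*; p. 309 *"This
is obtained in the Gaussian integration estimate, using the fact that V^{(k)}(Y) is a small polynomial in A^{(k)}, φ^{(k)}. [The
restrictions disappear as t → 0, so V^{(k)}(Y) cannot be replaced by its supremum.] The factors e^{−tV^{(k)}(Y)} − 1 can be bounded as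
before, because the coefficient t in front of V^{(k)}(Y) plus a small power of e_k easily beat the bounds A^{(k)}, φ^{(k)} ≦ cp(e_k)."* —
**POLYNOMIAL INTERACTIONS**: the gen-7 p. 308 chain (`BIJ88RestrictedInteraction308` … `BIJ88PerturbativeRemainder308`) carries the
interaction as a BOUNDED measurable `W` (`|W| ≤ K`, the binder of `BIJ88Perturbative341`); print's `Ṽ` is a polynomial in the SAME
fields that `χ′_{Λ,t}` restricts, bounded only ON THE SUPPORT of `χ′_{Λ,t}` and with a t-DEPENDENT bound `≲ p(te_k)^m`.  This file is
the TRUNCATION PRINCIPLE that transfers the chain to such `W`.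

statement-level skeleton of published theorems with citation tags; proofs where landed; nothing here is a claim about the Yang–Mills mass gap

ERRATUM (v1.1, docstring only; referee ref-5 gen 28 ASK (a); p. 309 re-read as an IMAGE, `lit-balaban-ref-1/renders/cmp114/original-p053-x2.png`):
print reads *"… using the fact that V^{(k)}(Y) is a small polynomial in A^{(k)}, φ^{(k)}"* (NO tilde on `V^{(k)}(Y)`; `Ṽ^{(k)}` is only
the sum `Ṽ^{(k)}(Λ₁₂^{(k)}) = Σ_Y V^{(k)}(Y)` of (5.14.1)) and *"… easily beat the bounds A^{(k)}, φ^{(k)} ≦ cp(e_k)"* (`≦ cp(e_k)`, NOT the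
`cp(te_k)` v1 quoted from the text layer).  Declarations are unchanged: the Lean radii `c_b·p(te_k)` are those of the p. 308
interpolated restriction `χ_{Λ₁₂^{(k)},t}` ("defined as above replacing p(e_k) with p(te_k)"), not a quotation of this sentence.

HYPOTHESIS SHAPE (displayed, faithful to *"a small polynomial in A^{(k)}, φ^{(k)}"*): `|W(ω)| ≤ K·(1 + Σ_{b∈Λ} |Φ_b(ω)|)^m` — polynomial
growth of degree `m` in the restricted fields, `K ≥ 0` (the "small" coefficient; smallness is not used here).

WHAT THIS FILE ADDS (theorems only; no definitions, no `Prop` facts; axioms standard).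
* §1 the support of `χ′_{Λ,t}`: `p(te_k) > 0` and `t ↦ p(te_k)` is antitone on the branch; `χ′_{Λ,t}(ω) = 0` as soon as one field
  exceeds its radius `c_b p(te_k)`; hence for `0 < a ≤ t`, `te_k < 1` the IDENTITY `χ′_{Λ,t}·e^{−tW} = χ′_{Λ,t}·e^{−t·W_a}` with the
  TRUNCATED interaction `W_a := W·𝟙{∀ b ∈ Λ, |Φ_b| ≤ c_b p(ae_k)}` (`restrictedInteraction_eq_truncated`), which IS bounded:
  `|W_a| ≤ K(1 + Σ_b c_b p(ae_k))^m` (`abs_truncated_le`) and measurable.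
* §2 consequently on the branch `0 < t`, `te_k < e^{−1}` the restricted interacting family `z(t) = ∫ χ′_{Λ,t}e^{−tW} dμ` with a
  POLYNOMIALLY BOUNDED `W` agrees near every `t₀` with the bounded-`W` family of the gen-7 chain (`W_{t₀/2}`): it is `Cⁿ` at `t₀` for
  every `n` (`contDiffAt_integral_polyInteraction`) and **`z^{(n)}(t₀) = ∫ ∂ⁿ_t[χ′_{Λ,t}e^{−tW}](t₀) dμ`** with the TRUE `W`
  (`iteratedDeriv_integral_polyInteraction`; off the box both integrands vanish identically near `t₀`); `log z` is `Cⁿ` where `z ≠ 0`.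
* §3 positivity transfers too: `z(t) = z_{W_t}(t)`, so `BIJ88ZtPositivity308` gives `e^{−tK_t}·μ(small-field box) ≤ z(t)` with
  `K_t = K(1 + Σ_b c_b p(te_k))^m` and **`z(t) > 0`** for a non-negative profile and centered jointly Gaussian fields
  (`integral_polyInteraction_pos`, `integral_polyInteraction_ne_zero_Ioc`).
Sequel (limits `t → 0⁺`, Taylor, (5.14.1)–(5.14.2) for polynomial `W`): `BIJ88PolyInteractionLimits308`.

PDF held: `paper:balaban1988-cmp114-bij-abelian-higgs-effective-action` (journal page = PDF page + 256); pp. 308–309 [PDF 52–53].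

CITATION HEADER (lean-in-tree rule).  Part of the lit-balaban TYPED SKELETON (HOME `run/shared/lean/pub/lit-balaban/`), Phase 2,
seat p36 (gen 8, unit `lit-balaban-p36`); rows **C2.Eq5.14.1-5.14.2** and **C2.Eq5.14.3-5.14.4** (p. 309 sentence) of
`HOME/lit-balaban-r16/ROWS-C2-part2.md` (owner r16; typed leaves untouched).
-/

namespace Literature.MathematicalPhysics.QuantumFieldTheory.BalabanImbrieJaffe1984to88.BIJ88PolyInteraction308

open MeasureTheory ProbabilityTheory Filter Set
open scoped Topology
open BIJ88Sect2Statements (pLog)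
open BIJ88Sect5Statements (CutoffProfile cutoff)

/-! ## §1 The support of `χ′_{Λ,t}` and the truncated interaction -/

section Support

variable (χ : CutoffProfile) {ι Ω : Type*} [MeasurableSpace Ω]

/-- `p(te_k) > 0` on the branch `0 < t`, `te_k < 1`. [cite: BalabanImbrieJaffe1988, (2.33) p.263] -/
theorem pLog_scale_pos (p : ℝ) {ek t : ℝ} (hek : 0 < ek) (ht : 0 < t) (h1 : t * ek < 1) : 0 < pLog p (t * ek) := by
  rw [BIJ88ChiTDeriv309.pLog_eq_rpow_neg_log p (mul_pos ht hek) h1]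
  exact Real.rpow_pos_of_pos (by have := Real.log_neg (mul_pos ht hek) h1; linarith) _

/-- `t ↦ p(te_k)` is antitone on the branch (`p ≥ 0`): for `0 < a ≤ t`, `te_k < 1`, `p(te_k) ≤ p(ae_k)` — the radii of the restrictions
shrink as `t` grows. [cite: BalabanImbrieJaffe1988, (2.33) p.263] -/
theorem pLog_scale_anti {p : ℝ} (hp : 0 ≤ p) {ek a t : ℝ} (hek : 0 < ek) (ha : 0 < a) (hat : a ≤ t) (h1 : t * ek < 1) :
    pLog p (t * ek) ≤ pLog p (a * ek) := by
  have ht : 0 < t := ha.trans_le hat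
  have ha1 : a * ek < 1 := lt_of_le_of_lt (mul_le_mul_of_nonneg_right hat hek.le) h1
  rw [BIJ88ChiTDeriv309.pLog_eq_rpow_neg_log p (mul_pos ht hek) h1,
    BIJ88ChiTDeriv309.pLog_eq_rpow_neg_log p (mul_pos ha hek) ha1]
  have hlog : Real.log (a * ek) ≤ Real.log (t * ek) :=
    Real.log_le_log (mul_pos ha hek) (mul_le_mul_of_nonneg_right hat hek.le)
  have hpos : 0 < -Real.log (t * ek) := by have := Real.log_neg (mul_pos ht hek) h1; linarith
  exact Real.rpow_le_rpow hpos.le (by linarith) hp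

/-- **`χ′_{Λ,t}(ω) = 0` as soon as one restricted field reaches its radius**: `c_b p(te_k) ≤ |Φ_b(ω)|` for some `b ∈ Λ` (`c_b > 0`;
(5.2.4): `χ(q, x) = 0` for `|x| ≥ q`). [cite: BalabanImbrieJaffe1988, (5.2.4) p.278] -/
theorem prod_cutoff_t_eq_zero_of_le (p : ℝ) (B : Finset ι) (A c : ι → ℝ) {ek t : ℝ} (hek : 0 < ek) (ht : 0 < t) (h1 : t * ek < 1)
    {b : ι} (hb : b ∈ B) (hcb : 0 < c b) (hA : c b * pLog p (t * ek) ≤ |A b|) :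
    (∏ b ∈ B, cutoff χ (c b * pLog p (t * ek)) (A b)) = 0 :=
  Finset.prod_eq_zero hb (BIJ88Sect5Statements.cutoff_eq_zero χ (mul_pos hcb (pLog_scale_pos p hek ht h1)) hA)

/-- Off the field box of radius `p(ae_k)` the restricted characteristic function vanishes for all LATER parameters: if
`|Φ_b(ω)| > c_b p(ae_k)` for some `b ∈ Λ` then `χ′_{Λ,t}(ω) = 0` for every `t ≥ a` on the branch (`p ≥ 0`).
[cite: BalabanImbrieJaffe1988, (5.14.2) p.308] -/
theorem prod_cutoff_t_eq_zero_of_not_mem_box {p : ℝ} (hp : 0 ≤ p) (B : Finset ι) (A c : ι → ℝ) (hc : ∀ b ∈ B, 0 < c b)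
    {ek a t : ℝ} (hek : 0 < ek) (ha : 0 < a) (hat : a ≤ t) (h1 : t * ek < 1)
    (hA : ¬ ∀ b ∈ B, |A b| ≤ c b * pLog p (a * ek)) :
    (∏ b ∈ B, cutoff χ (c b * pLog p (t * ek)) (A b)) = 0 := by
  simp only [not_forall, not_le, exists_prop] at hA
  obtain ⟨b, hb, hlt⟩ := hA
  exact prod_cutoff_t_eq_zero_of_le χ p B A c hek (ha.trans_le hat) h1 hb (hc b hb)
    ((mul_le_mul_of_nonneg_left (pLog_scale_anti hp hek ha hat h1) (hc b hb).le).trans hlt.le)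

omit [MeasurableSpace Ω] in
/-- **The truncation identity.**  For `0 < a ≤ t`, `te_k < 1`: `χ′_{Λ,t}·e^{−tW} = χ′_{Λ,t}·e^{−tW_a}` pointwise, where
`W_a = W·𝟙{∀ b ∈ Λ, |Φ_b| ≤ c_b p(ae_k)}` is the interaction truncated to the field box of radius `p(ae_k)` — outside that box
`χ′_{Λ,t}` vanishes. [cite: BalabanImbrieJaffe1988, (5.14.2) p.308] -/
theorem restrictedInteraction_eq_truncated {p : ℝ} (hp : 0 ≤ p) (B : Finset ι) (Φ : ι → Ω → ℝ) {c : ι → ℝ}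
    (hc : ∀ b ∈ B, 0 < c b) (W : Ω → ℝ) {ek a t : ℝ} (hek : 0 < ek) (ha : 0 < a) (hat : a ≤ t) (h1 : t * ek < 1) (ω : Ω) :
    (∏ b ∈ B, cutoff χ (c b * pLog p (t * ek)) (Φ b ω)) * Real.exp (-(t * W ω)) =
      (∏ b ∈ B, cutoff χ (c b * pLog p (t * ek)) (Φ b ω)) *
        Real.exp (-(t * Set.indicator {ω | ∀ b ∈ B, |Φ b ω| ≤ c b * pLog p (a * ek)} W ω)) := by
  by_cases hω : ω ∈ {ω | ∀ b ∈ B, |Φ b ω| ≤ c b * pLog p (a * ek)}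
  · rw [Set.indicator_of_mem hω]
  · rw [prod_cutoff_t_eq_zero_of_not_mem_box χ hp B (fun b => Φ b ω) c hc hek ha hat h1 hω, zero_mul, zero_mul]

/-- The field box `{∀ b ∈ Λ, |Φ_b| ≤ r_b}` is measurable for measurable fields. [cite: BalabanImbrieJaffe1988, (5.14.2) p.308] -/
theorem measurableSet_fieldBox (B : Finset ι) {Φ : ι → Ω → ℝ} (hΦ : ∀ b ∈ B, Measurable (Φ b)) (r : ι → ℝ) :
    MeasurableSet {ω | ∀ b ∈ B, |Φ b ω| ≤ r b} := by
  have h : {ω | ∀ b ∈ B, |Φ b ω| ≤ r b} = ⋂ b ∈ B, {ω | |Φ b ω| ≤ r b} := by ext; simp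
  rw [h]
  exact Finset.measurableSet_biInter B fun b hb =>
    measurableSet_le (continuous_abs.measurable.comp (hΦ b hb)) measurable_const

/-- The truncated interaction is measurable. [cite: BalabanImbrieJaffe1988, (5.14.2) p.308] -/
theorem measurable_truncated (p : ℝ) (B : Finset ι) {Φ : ι → Ω → ℝ} (hΦ : ∀ b ∈ B, Measurable (Φ b)) (c : ι → ℝ)
    {W : Ω → ℝ} (hW : Measurable W) (ek a : ℝ) :
    Measurable (Set.indicator {ω | ∀ b ∈ B, |Φ b ω| ≤ c b * pLog p (a * ek)} W) :=
  hW.indicator (measurableSet_fieldBox B hΦ _)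

omit [MeasurableSpace Ω] in
/-- **The truncated interaction IS bounded**: under the polynomial-growth hypothesis `|W| ≤ K(1 + Σ_{b∈Λ}|Φ_b|)^m` (`K ≥ 0`, `c_b > 0`),
`|W_a| ≤ K·(1 + Σ_{b∈Λ} c_b p(ae_k))^m` — print's *"the bounds A^{(k)}, φ^{(k)} ≦ cp(e_k)"* (at parameter `t` the radii of
`χ_{Λ,t}` are `c_b p(te_k)`, p. 308) turned into a sup bound for the interaction ON THE SUPPORT of the restrictions. [cite: BalabanImbrieJaffe1988,
p.309 (Sect. 5.14)] -/
theorem abs_truncated_le (p : ℝ) (B : Finset ι) (Φ : ι → Ω → ℝ) {c : ι → ℝ} (hc : ∀ b ∈ B, 0 < c b) {W : Ω → ℝ} {K : ℝ}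
    (hK : 0 ≤ K) {m : ℕ} (hWg : ∀ ω, |W ω| ≤ K * (1 + ∑ b ∈ B, |Φ b ω|) ^ m) (ek a : ℝ) (ω : Ω) :
    |Set.indicator {ω | ∀ b ∈ B, |Φ b ω| ≤ c b * pLog p (a * ek)} W ω| ≤ K * (1 + ∑ b ∈ B, c b * pLog p (a * ek)) ^ m := by
  have hsum0 : 0 ≤ ∑ b ∈ B, c b * pLog p (a * ek) :=
    Finset.sum_nonneg fun b hb => mul_nonneg (hc b hb).le (BIJ88RestrictionsVanish308.pLog_nonneg _ _)
  by_cases hω : ω ∈ {ω | ∀ b ∈ B, |Φ b ω| ≤ c b * pLog p (a * ek)}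
  · rw [Set.indicator_of_mem hω]
    refine (hWg ω).trans (mul_le_mul_of_nonneg_left ?_ hK)
    have h0 : 0 ≤ 1 + ∑ b ∈ B, |Φ b ω| := by positivity
    exact pow_le_pow_left₀ h0 (by linarith [Finset.sum_le_sum fun b hb => hω b hb]) _
  · rw [Set.indicator_of_notMem hω, abs_zero]
    positivity

end Support

/-! ## §2 Smoothness and the derivative formula on the branch for polynomially bounded interactions -/

section Branch

variable (χ : CutoffProfile) {ι Ω : Type*} [MeasurableSpace Ω]

/-- Near every `t₀` of the branch the polynomial-`W` family agrees with the truncated (bounded-`W`) family: for `t ∈ (t₀/2, e^{−1}/e_k)`,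
`∫ χ′_{Λ,t}e^{−tW} dμ = ∫ χ′_{Λ,t}e^{−tW_{t₀/2}} dμ`. [cite: BalabanImbrieJaffe1988, (5.14.2) p.308] -/
theorem integral_eventuallyEq_truncated {p : ℝ} (hp : 0 ≤ p) (μ : Measure Ω) (B : Finset ι) (Φ : ι → Ω → ℝ) {c : ι → ℝ}
    (hc : ∀ b ∈ B, 0 < c b) (W : Ω → ℝ) {ek t₀ : ℝ} (hek : 0 < ek) (ht₀ : 0 < t₀) (h1 : t₀ * ek < Real.exp (-1)) :
    (fun t => ∫ ω, (∏ b ∈ B, cutoff χ (c b * pLog p (t * ek)) (Φ b ω)) * Real.exp (-(t * W ω)) ∂μ) =ᶠ[𝓝 t₀]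
      fun t => ∫ ω, (∏ b ∈ B, cutoff χ (c b * pLog p (t * ek)) (Φ b ω)) *
        Real.exp (-(t * Set.indicator {ω | ∀ b ∈ B, |Φ b ω| ≤ c b * pLog p (t₀ / 2 * ek)} W ω)) ∂μ := by
  have hmem : Set.Ioo (t₀ / 2) (Real.exp (-1) / ek) ∈ 𝓝 t₀ :=
    isOpen_Ioo.mem_nhds ⟨by linarith, by rwa [lt_div_iff₀ hek]⟩
  filter_upwards [hmem] with t ht
  have ht1 : t * ek < 1 := ((lt_div_iff₀ hek).mp ht.2).trans (by rw [← Real.exp_zero]; exact Real.exp_lt_exp.mpr (by norm_num))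
  exact integral_congr_ae (Filter.Eventually.of_forall fun ω =>
    restrictedInteraction_eq_truncated χ hp B Φ hc W hek (by linarith) ht.1.le ht1 ω)

/-- **`z(t) = ∫ χ′_{Λ,t}e^{−tW} dμ` with a POLYNOMIALLY BOUNDED interaction is `Cⁿ` at every point of the branch**, every `n`
(any finite measure, measurable fields, `c_b > 0`, `p ≥ 0`, measurable `W` with `|W| ≤ K(1 + Σ|Φ_b|)^m`).
[cite: BalabanImbrieJaffe1988, (5.14.3) p.309] -/
theorem contDiffAt_integral_polyInteraction {p : ℝ} (hp : 0 ≤ p) (μ : Measure Ω) [IsFiniteMeasure μ] (B : Finset ι)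
    {Φ : ι → Ω → ℝ} (hΦ : ∀ b ∈ B, Measurable (Φ b)) {c : ι → ℝ} (hc : ∀ b ∈ B, 0 < c b) {W : Ω → ℝ} (hW : Measurable W)
    {K : ℝ} (hK : 0 ≤ K) {m : ℕ} (hWg : ∀ ω, |W ω| ≤ K * (1 + ∑ b ∈ B, |Φ b ω|) ^ m) {ek : ℝ} (hek : 0 < ek) (n : ℕ) {t : ℝ}
    (ht : 0 < t) (h1 : t * ek < Real.exp (-1)) :
    ContDiffAt ℝ n (fun t => ∫ ω, (∏ b ∈ B, cutoff χ (c b * pLog p (t * ek)) (Φ b ω)) * Real.exp (-(t * W ω)) ∂μ) t :=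
  (BIJ88GaussianMoments308.contDiffAt_integral_restrictedInteraction χ p μ B hΦ (fun b hb => (hc b hb).ne')
    (measurable_truncated p B hΦ c hW ek (t / 2)) (abs_truncated_le p B Φ hc hK hWg ek (t / 2)) hek n ht
    h1).congr_of_eventuallyEq (integral_eventuallyEq_truncated χ hp μ B Φ hc W hek ht h1)

/-- Off the field box of radius `p((t₀/2)e_k)` the whole integrand `s ↦ χ′_{Λ,s}(ω)e^{−sw}` vanishes identically near `t₀`, for ANY
value `w` of the interaction. [cite: BalabanImbrieJaffe1988, (5.14.2) p.308] -/
theorem integrand_eventuallyEq_zero_of_not_mem_box {p : ℝ} (hp : 0 ≤ p) (B : Finset ι) (A c : ι → ℝ) (hc : ∀ b ∈ B, 0 < c b)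
    (w : ℝ) {ek t₀ : ℝ} (hek : 0 < ek) (ht₀ : 0 < t₀) (h1 : t₀ * ek < Real.exp (-1))
    (hA : ¬ ∀ b ∈ B, |A b| ≤ c b * pLog p (t₀ / 2 * ek)) :
    (fun s => (∏ b ∈ B, cutoff χ (c b * pLog p (s * ek)) (A b)) * Real.exp (-(s * w))) =ᶠ[𝓝 t₀] fun _ => (0 : ℝ) := by
  have hmem : Set.Ioo (t₀ / 2) (Real.exp (-1) / ek) ∈ 𝓝 t₀ :=
    isOpen_Ioo.mem_nhds ⟨by linarith, by rwa [lt_div_iff₀ hek]⟩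
  filter_upwards [hmem] with s hs
  have hs1 : s * ek < 1 := ((lt_div_iff₀ hek).mp hs.2).trans (by rw [← Real.exp_zero]; exact Real.exp_lt_exp.mpr (by norm_num))
  rw [prod_cutoff_t_eq_zero_of_not_mem_box χ hp B A c hc hek (by linarith) hs.1.le hs1 hA, zero_mul]

/-- **All-orders differentiation under the integral for polynomially bounded interactions**:
`z^{(n)}(t₀) = ∫ ∂ⁿ_t[χ′_{Λ,t}e^{−tW}](t₀) dμ` with the TRUE interaction `W` (branch point `t₀`; hypotheses as above) — the gen-7
statement `BIJ88RestrictedInteractionAllOrders308.iteratedDeriv_integral_restrictedInteraction` with `|W| ≤ K` replaced by polynomial growth.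
[cite: BalabanImbrieJaffe1988, (5.14.3) p.309] -/
theorem iteratedDeriv_integral_polyInteraction {p : ℝ} (hp : 0 ≤ p) (μ : Measure Ω) [IsFiniteMeasure μ] (B : Finset ι)
    {Φ : ι → Ω → ℝ} (hΦ : ∀ b ∈ B, Measurable (Φ b)) {c : ι → ℝ} (hc : ∀ b ∈ B, 0 < c b) {W : Ω → ℝ} (hW : Measurable W)
    {K : ℝ} (hK : 0 ≤ K) {m : ℕ} (hWg : ∀ ω, |W ω| ≤ K * (1 + ∑ b ∈ B, |Φ b ω|) ^ m) {ek : ℝ} (hek : 0 < ek) (n : ℕ) {t₀ : ℝ}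
    (ht₀ : 0 < t₀) (h1 : t₀ * ek < Real.exp (-1)) :
    iteratedDeriv n (fun t => ∫ ω, (∏ b ∈ B, cutoff χ (c b * pLog p (t * ek)) (Φ b ω)) * Real.exp (-(t * W ω)) ∂μ) t₀ =
      ∫ ω, iteratedDeriv n (fun s => (∏ b ∈ B, cutoff χ (c b * pLog p (s * ek)) (Φ b ω)) * Real.exp (-(s * W ω))) t₀ ∂μ := by
  rw [(integral_eventuallyEq_truncated χ hp μ B Φ hc W hek ht₀ h1).iteratedDeriv_eq n,
    BIJ88RestrictedInteractionAllOrders308.iteratedDeriv_integral_restrictedInteraction χ p μ B hΦ (fun b hb => (hc b hb).ne')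
      (measurable_truncated p B hΦ c hW ek (t₀ / 2)) (abs_truncated_le p B Φ hc hK hWg ek (t₀ / 2)) hek n ht₀ h1]
  refine integral_congr_ae (Filter.Eventually.of_forall fun ω => ?_)
  beta_reduce
  by_cases hω : ω ∈ {ω | ∀ b ∈ B, |Φ b ω| ≤ c b * pLog p (t₀ / 2 * ek)}
  · simp only [Set.indicator_of_mem hω]
  · have hω' : ¬ ∀ b ∈ B, |Φ b ω| ≤ c b * pLog p (t₀ / 2 * ek) := hω
    rw [(integrand_eventuallyEq_zero_of_not_mem_box χ hp B (fun b => Φ b ω) c hc _ hek ht₀ h1 hω').iteratedDeriv_eq n,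
      (integrand_eventuallyEq_zero_of_not_mem_box χ hp B (fun b => Φ b ω) c hc (W ω) hek ht₀ h1 hω').iteratedDeriv_eq n]

/-- The integrands `ω ↦ ∂ⁿ_t[χ′_{Λ,t}(ω)e^{−tW(ω)}](t₀)` are integrable (they agree with the truncated, bounded ones).
[cite: BalabanImbrieJaffe1988, (5.14.3) p.309] -/
theorem integrable_iteratedDeriv_polyInteraction {p : ℝ} (hp : 0 ≤ p) (μ : Measure Ω) [IsFiniteMeasure μ] (B : Finset ι)
    {Φ : ι → Ω → ℝ} (hΦ : ∀ b ∈ B, Measurable (Φ b)) {c : ι → ℝ} (hc : ∀ b ∈ B, 0 < c b) {W : Ω → ℝ} (hW : Measurable W)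
    {K : ℝ} (hK : 0 ≤ K) {m : ℕ} (hWg : ∀ ω, |W ω| ≤ K * (1 + ∑ b ∈ B, |Φ b ω|) ^ m) {ek : ℝ} (hek : 0 < ek) (n : ℕ) {t₀ : ℝ}
    (ht₀ : 0 < t₀) (h1 : t₀ * ek < Real.exp (-1)) :
    Integrable (fun ω => iteratedDeriv (n + 1)
      (fun s => (∏ b ∈ B, cutoff χ (c b * pLog p (s * ek)) (Φ b ω)) * Real.exp (-(s * W ω))) t₀) μ := by
  have h := (BIJ88RestrictedInteractionAllOrders308.hasDerivAt_integral_iteratedDeriv_restrictedInteraction χ p μ B hΦ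
    (fun b hb => (hc b hb).ne') (measurable_truncated p B hΦ c hW ek (t₀ / 2)) (abs_truncated_le p B Φ hc hK hWg ek (t₀ / 2))
    hek ht₀ h1 n).1
  refine h.congr (Filter.Eventually.of_forall fun ω => ?_)
  beta_reduce
  by_cases hω : ω ∈ {ω | ∀ b ∈ B, |Φ b ω| ≤ c b * pLog p (t₀ / 2 * ek)}
  · simp only [Set.indicator_of_mem hω]
  · have hω' : ¬ ∀ b ∈ B, |Φ b ω| ≤ c b * pLog p (t₀ / 2 * ek) := hω
    rw [(integrand_eventuallyEq_zero_of_not_mem_box χ hp B (fun b => Φ b ω) c hc _ hek ht₀ h1 hω').iteratedDeriv_eq (n + 1),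
      (integrand_eventuallyEq_zero_of_not_mem_box χ hp B (fun b => Φ b ω) c hc (W ω) hek ht₀ h1 hω').iteratedDeriv_eq (n + 1)]

/-- **`log z` is `Cⁿ` at every `t ∈ (0,1]`** for a polynomially bounded interaction (`e_k < e^{−1}`, `z_t ≠ 0` on `(0,1]`).
[cite: BalabanImbrieJaffe1988, (5.14.1) p.308] -/
theorem contDiffAt_log_polyInteraction {p : ℝ} (hp : 0 ≤ p) (μ : Measure Ω) [IsFiniteMeasure μ] (B : Finset ι)
    {Φ : ι → Ω → ℝ} (hΦ : ∀ b ∈ B, Measurable (Φ b)) {c : ι → ℝ} (hc : ∀ b ∈ B, 0 < c b) {W : Ω → ℝ} (hW : Measurable W)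
    {K : ℝ} (hK : 0 ≤ K) {m : ℕ} (hWg : ∀ ω, |W ω| ≤ K * (1 + ∑ b ∈ B, |Φ b ω|) ^ m) {ek : ℝ} (hek : 0 < ek)
    (hek1 : ek < Real.exp (-1))
    (hz : ∀ t ∈ Set.Ioc (0 : ℝ) 1, (∫ ω, (∏ b ∈ B, cutoff χ (c b * pLog p (t * ek)) (Φ b ω)) * Real.exp (-(t * W ω)) ∂μ) ≠ 0)
    (n : ℕ) {t : ℝ} (ht : t ∈ Set.Ioc (0 : ℝ) 1) :
    ContDiffAt ℝ n (fun t => Real.log (∫ ω, (∏ b ∈ B, cutoff χ (c b * pLog p (t * ek)) (Φ b ω)) * Real.exp (-(t * W ω)) ∂μ)) t := by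
  have h1 : ContDiffAt ℝ n Real.log
      (∫ ω, (∏ b ∈ B, cutoff χ (c b * pLog p (t * ek)) (Φ b ω)) * Real.exp (-(t * W ω)) ∂μ) :=
    Real.contDiffAt_log.mpr (hz t ht)
  have h2 := contDiffAt_integral_polyInteraction χ hp μ B hΦ hc hW hK hWg hek n ht.1
    (lt_of_le_of_lt (mul_le_of_le_one_left hek.le ht.2) hek1)
  exact h1.comp t h2

end Branch

/-! ## §3 Positivity transfers: `z_t > 0` for polynomially bounded interactions -/

section Positivity

variable (χ : CutoffProfile) {ι Ω : Type*} [MeasurableSpace Ω]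

/-- The integrand with a polynomially bounded interaction is integrable for `0 < t`, `te_k < 1` (it equals the truncated one, bounded
by `e^{tK_t}`). [cite: BalabanImbrieJaffe1988, (5.14.2) p.308] -/
theorem integrable_polyInteraction {p : ℝ} (hp : 0 ≤ p) (μ : Measure Ω) [IsFiniteMeasure μ] (B : Finset ι) {Φ : ι → Ω → ℝ}
    (hΦ : ∀ b ∈ B, Measurable (Φ b)) {c : ι → ℝ} (hc : ∀ b ∈ B, 0 < c b) {W : Ω → ℝ} (hW : Measurable W) {K : ℝ} (hK : 0 ≤ K)
    {m : ℕ} (hWg : ∀ ω, |W ω| ≤ K * (1 + ∑ b ∈ B, |Φ b ω|) ^ m) {ek t : ℝ} (hek : 0 < ek) (ht : 0 < t) (h1 : t * ek < 1) :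
    Integrable (fun ω => (∏ b ∈ B, cutoff χ (c b * pLog p (t * ek)) (Φ b ω)) * Real.exp (-(t * W ω))) μ := by
  have h := BIJ88ZtPositivity308.integrable_restrictedInteraction χ p μ B hΦ c (measurable_truncated p B hΦ c hW ek t)
    (abs_truncated_le p B Φ hc hK hWg ek t) ek ht.le
  exact h.congr (Filter.Eventually.of_forall fun ω => (restrictedInteraction_eq_truncated χ hp B Φ hc W hek ht le_rfl h1 ω).symm)

/-- **The small-field lower bound for polynomially bounded interactions**: with `K_t = K(1 + Σ_b c_b p(te_k))^m`,
`e^{−tK_t}·μ(∀ b ∈ Λ, |Φ_b| < (9/10)c₀) ≤ z_t` (non-negative profile, `c_b ≥ c₀ > 0`, `0 < t`, `te_k ≤ e^{−1}`).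
[cite: BalabanImbrieJaffe1988, (5.14.2) p.308] -/
theorem exp_mul_measureReal_smallBall_le_integral_poly (hχ : ∀ x, 0 ≤ χ.χ₁ x) {p : ℝ} (hp : 0 ≤ p) (μ : Measure Ω)
    [IsFiniteMeasure μ] (B : Finset ι) {Φ : ι → Ω → ℝ} (hΦ : ∀ b ∈ B, Measurable (Φ b)) {c : ι → ℝ} {c₀ : ℝ} (hc₀ : 0 < c₀)
    (hcb : ∀ b ∈ B, c₀ ≤ c b) {W : Ω → ℝ} (hW : Measurable W) {K : ℝ} (hK : 0 ≤ K) {m : ℕ}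
    (hWg : ∀ ω, |W ω| ≤ K * (1 + ∑ b ∈ B, |Φ b ω|) ^ m) {ek t : ℝ} (hek : 0 < ek) (ht : 0 < t) (h1 : t * ek ≤ Real.exp (-1)) :
    Real.exp (-(t * (K * (1 + ∑ b ∈ B, c b * pLog p (t * ek)) ^ m))) * μ.real {ω | ∀ b ∈ B, |Φ b ω| < 9 / 10 * c₀} ≤
      ∫ ω, (∏ b ∈ B, cutoff χ (c b * pLog p (t * ek)) (Φ b ω)) * Real.exp (-(t * W ω)) ∂μ := by
  have hc : ∀ b ∈ B, 0 < c b := fun b hb => hc₀.trans_le (hcb b hb)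
  have h1' : t * ek < 1 := h1.trans_lt (by rw [← Real.exp_zero]; exact Real.exp_lt_exp.mpr (by norm_num))
  have h := BIJ88ZtPositivity308.exp_mul_measureReal_smallBall_le_integral χ hχ hp μ B hΦ hc₀ hcb
    (measurable_truncated p B hΦ c hW ek t) (abs_truncated_le p B Φ hc hK hWg ek t) hek ht h1
  refine h.trans (le_of_eq (integral_congr_ae (Filter.Eventually.of_forall fun ω =>
    (restrictedInteraction_eq_truncated χ hp B Φ hc W hek ht le_rfl h1' ω).symm)))

/-- **`z_t > 0` on the branch for a polynomially bounded interaction and centered jointly Gaussian fields** (non-negative profile,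
`c_b ≥ c₀ > 0`, `p ≥ 0`, `0 < t`, `te_k ≤ e^{−1}`). [cite: BalabanImbrieJaffe1988, (5.14.2) p.308] -/
theorem integral_polyInteraction_pos (hχ : ∀ x, 0 ≤ χ.χ₁ x) {p : ℝ} (hp : 0 ≤ p) (P : Measure Ω) [IsProbabilityMeasure P]
    (B : Finset ι) {Φ : ι → Ω → ℝ} (hJ : HasGaussianLaw (fun ω (b : B) => Φ b ω) P) (hΦ : ∀ b ∈ B, Measurable (Φ b))
    (h0 : ∀ b ∈ B, P[Φ b] = 0) {c : ι → ℝ} {c₀ : ℝ} (hc₀ : 0 < c₀) (hcb : ∀ b ∈ B, c₀ ≤ c b) {W : Ω → ℝ} (hW : Measurable W)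
    {K : ℝ} (hK : 0 ≤ K) {m : ℕ} (hWg : ∀ ω, |W ω| ≤ K * (1 + ∑ b ∈ B, |Φ b ω|) ^ m) {ek t : ℝ} (hek : 0 < ek) (ht : 0 < t)
    (h1 : t * ek ≤ Real.exp (-1)) :
    0 < ∫ ω, (∏ b ∈ B, cutoff χ (c b * pLog p (t * ek)) (Φ b ω)) * Real.exp (-(t * W ω)) ∂P :=
  lt_of_lt_of_le (mul_pos (Real.exp_pos _) (BIJ88ZtPositivity308.measureReal_smallBall_pos_of_hasGaussianLaw P B hJ hΦ h0
    (by linarith : (0 : ℝ) < 9 / 10 * c₀)))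
    (exp_mul_measureReal_smallBall_le_integral_poly χ hχ hp P B hΦ hc₀ hcb hW hK hWg hek ht h1)

/-- **`hz` for polynomially bounded interactions**: `z_t ≠ 0` for every `t ∈ (0,1]` (`e_k ≤ e^{−1}`; hypotheses as above).
[cite: BalabanImbrieJaffe1988, (5.14.2) p.308] -/
theorem integral_polyInteraction_ne_zero_Ioc (hχ : ∀ x, 0 ≤ χ.χ₁ x) {p : ℝ} (hp : 0 ≤ p) (P : Measure Ω) [IsProbabilityMeasure P]
    (B : Finset ι) {Φ : ι → Ω → ℝ} (hJ : HasGaussianLaw (fun ω (b : B) => Φ b ω) P) (hΦ : ∀ b ∈ B, Measurable (Φ b))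
    (h0 : ∀ b ∈ B, P[Φ b] = 0) {c : ι → ℝ} {c₀ : ℝ} (hc₀ : 0 < c₀) (hcb : ∀ b ∈ B, c₀ ≤ c b) {W : Ω → ℝ} (hW : Measurable W)
    {K : ℝ} (hK : 0 ≤ K) {m : ℕ} (hWg : ∀ ω, |W ω| ≤ K * (1 + ∑ b ∈ B, |Φ b ω|) ^ m) {ek : ℝ} (hek : 0 < ek)
    (hek1 : ek ≤ Real.exp (-1)) :
    ∀ t ∈ Set.Ioc (0 : ℝ) 1, (∫ ω, (∏ b ∈ B, cutoff χ (c b * pLog p (t * ek)) (Φ b ω)) * Real.exp (-(t * W ω)) ∂P) ≠ 0 :=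
  fun _t ht => (integral_polyInteraction_pos χ hχ hp P B hJ hΦ h0 hc₀ hcb hW hK hWg hek ht.1
    (BIJ88ZtPositivity308.mul_le_exp_neg_one_of_Ioc hek hek1 ht)).ne'

end Positivity

end Literature.MathematicalPhysics.QuantumFieldTheory.BalabanImbrieJaffe1984to88.BIJ88PolyInteraction308
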